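import Summits.Ventures.PercRepro2.CaseOneTForms
import Summits.Ventures.PercRepro2.CaseOneA2EdgeQB
import Summits.Ventures.PercRepro2.CaseOneA2EdgeDelete

/-!
# The `(ii)`-side forms along an `a₂a₃`-edge, UNCONDITIONALLY, with the T-world form
(blind cell PercRepro2, p1 g30)

With `e₂ = {a₂, a₃}` forced open, `Q = PD ⊔ T` of `G − e₂`, so the forced-open Q-pair
`c¹ = (P₁(Q, o ∈ U), P₁(Q))` satisfies `P₁(Q) = D₀ + P₀(T)` and `P₁(Q, o ∈ U) ≥ D₀ₒ + P₀(T, o ∈ U)`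
(`prob_Q_update_one_eq_Dpd_add`, `Dqo_update_one_ge`); since the `b`-bracket `B(y) = y₁ P₂ − y₀ P₁`
is `≤ 0`, the `(ii)` form of `G − e₂` at the pair `c¹` is AT LEAST its form at the PD pair plus its
form at the T-pair (**`lamT_c1_ge`**). The T-pair coefficient `Λ(c_T⁰, y¹)` is `≥ 0` when `(ii-T)`
holds for `G − e₂` (**`lamT_c0_y1_nonneg`**, the `b`-threshold monotonicity with `odds_t`). Hence,
with the identities `iiExprQ_a2_edge` and **`iiExprT_a2_edge`** (the T-form is `(1 − r)` times a
quadratic in `r` whose Bernstein coefficients are the forms of `G − e₂` at `c_T⁰ / c¹` and `y⁰ / y¹`):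

* **`zSplitIIQ_of_a2_edge_T`**: `(ii)(G − e₂) ∧ (ii-Q)(G − e₂) ∧ (ii-T)(G − e₂) ⟹ (ii-Q)(G)`,
* **`zSplitIIT_of_a2_edge`**: `(ii)(G − e₂) ∧ (ii-T)(G − e₂) ⟹ (ii-T)(G)`,

with no threshold hypothesis (the conditional `zSplitIIQ_of_a2_edge` of `CaseOneA2EdgeQ.lean` is
the special case where the forced-open pair dominates). Together with `zSplitII_of_a2_edge`: the
TRIPLE `(ii), (ii-Q), (ii-T)` is closed under the deletion of `a₂a₃`-edges. Own code; standard
axioms.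
-/

namespace Summit.Ventures.PercRepro2

namespace CaseOne

section TIdentity
variable {V : Type*} {E : Type*} [Fintype E] [DecidableEq E] {R : Type*} [CommRing R]
variable {ends : E → Sym2 V} {a₁ a₂ a₃ : V} {e₂ : E}

/-- **The T-threshold `(ii)` along an `a₂a₃`-edge**: `(1 − r)` times a quadratic in `r` whose
Bernstein coefficients are the `(ii)` forms of `G − e₂` at the T-pair / the forced-open Q-pair and
the two `b`-pairs. -/
theorem iiExprT_a2_edge (p : E → R) (he : ends e₂ = s(a₂, a₃)) (o b : V) :
    iiExprT p ends o a₁ a₂ a₃ b (Dto p ends o a₁ a₂ a₃) (Dt p ends a₁ a₂ a₃) =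
      (1 - p e₂) *
        ((1 - p e₂) ^ 2 *
            iiExprT (Function.update p e₂ 0) ends o a₁ a₂ a₃ b
              (Dto (Function.update p e₂ 0) ends o a₁ a₂ a₃)
              (Dt (Function.update p e₂ 0) ends a₁ a₂ a₃) +
          p e₂ * (1 - p e₂) *
            ((Dt (Function.update p e₂ 0) ends a₁ a₂ a₃ *
                (prob (Function.update p e₂ 1) (connEvent ends a₁ a₂)ᶜ *
                  prob (Function.update p e₂ 0) (connEvent ends a₂ b ∩ connEvent ends a₁ a₃ ∩
                    connEvent ends a₂ o ∩ (connEvent ends a₁ a₂)ᶜ) -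
                prob (Function.update p e₂ 1) (connEvent ends a₂ b ∩ (connEvent ends a₁ a₂)ᶜ) *
                  prob (Function.update p e₂ 0) (connEvent ends a₁ a₃ ∩ connEvent ends a₂ o ∩
                    (connEvent ends a₁ a₂)ᶜ)) -
              Dto (Function.update p e₂ 0) ends o a₁ a₂ a₃ *
                (prob (Function.update p e₂ 1) (connEvent ends a₁ a₂)ᶜ *
                  prob (Function.update p e₂ 0) (connEvent ends a₂ b ∩ connEvent ends a₁ a₃ ∩
                    (connEvent ends a₁ a₂)ᶜ) -
                prob (Function.update p e₂ 1) (connEvent ends a₂ b ∩ (connEvent ends a₁ a₂)ᶜ) *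
                  prob (Function.update p e₂ 0) (connEvent ends a₁ a₃ ∩ (connEvent ends a₁ a₂)ᶜ))) +
            (prob (Function.update p e₂ 1) (connEvent ends a₁ a₂)ᶜ *
                (prob (Function.update p e₂ 0) (connEvent ends a₁ a₂)ᶜ *
                  prob (Function.update p e₂ 0) (connEvent ends a₂ b ∩ connEvent ends a₁ a₃ ∩
                    connEvent ends a₂ o ∩ (connEvent ends a₁ a₂)ᶜ) -
                prob (Function.update p e₂ 0) (connEvent ends a₂ b ∩ (connEvent ends a₁ a₂)ᶜ) *
                  prob (Function.update p e₂ 0) (connEvent ends a₁ a₃ ∩ connEvent ends a₂ o ∩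
                    (connEvent ends a₁ a₂)ᶜ)) -
              Dqo (Function.update p e₂ 1) ends o a₁ a₂ *
                (prob (Function.update p e₂ 0) (connEvent ends a₁ a₂)ᶜ *
                  prob (Function.update p e₂ 0) (connEvent ends a₂ b ∩ connEvent ends a₁ a₃ ∩
                    (connEvent ends a₁ a₂)ᶜ) -
                prob (Function.update p e₂ 0) (connEvent ends a₂ b ∩ (connEvent ends a₁ a₂)ᶜ) *
                  prob (Function.update p e₂ 0) (connEvent ends a₁ a₃ ∩ (connEvent ends a₁ a₂)ᶜ)))) +
          p e₂ ^ 2 *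
            (prob (Function.update p e₂ 1) (connEvent ends a₁ a₂)ᶜ *
                (prob (Function.update p e₂ 1) (connEvent ends a₁ a₂)ᶜ *
                  prob (Function.update p e₂ 0) (connEvent ends a₂ b ∩ connEvent ends a₁ a₃ ∩
                    connEvent ends a₂ o ∩ (connEvent ends a₁ a₂)ᶜ) -
                prob (Function.update p e₂ 1) (connEvent ends a₂ b ∩ (connEvent ends a₁ a₂)ᶜ) *
                  prob (Function.update p e₂ 0) (connEvent ends a₁ a₃ ∩ connEvent ends a₂ o ∩
                    (connEvent ends a₁ a₂)ᶜ)) -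
              Dqo (Function.update p e₂ 1) ends o a₁ a₂ *
                (prob (Function.update p e₂ 1) (connEvent ends a₁ a₂)ᶜ *
                  prob (Function.update p e₂ 0) (connEvent ends a₂ b ∩ connEvent ends a₁ a₃ ∩
                    (connEvent ends a₁ a₂)ᶜ) -
                prob (Function.update p e₂ 1) (connEvent ends a₂ b ∩ (connEvent ends a₁ a₂)ᶜ) *
                  prob (Function.update p e₂ 0) (connEvent ends a₁ a₃ ∩ (connEvent ends a₁ a₂)ᶜ)))) := by
  rw [iiExprT_eq, iiExprT_eq, Dto_pin p e₂ o, Dt_pin p e₂, Dto_update_one p he o, Dt_update_one p he,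
    prob_a2_edge_of_subset_AQ p he (Y := connEvent ends a₂ b ∩ connEvent ends a₁ a₃ ∩
      connEvent ends a₂ o ∩ (connEvent ends a₁ a₂)ᶜ) (fun _ h => ⟨h.1.1.2, h.2⟩),
    prob_a2_edge_of_subset_AQ p he (Y := connEvent ends a₁ a₃ ∩ connEvent ends a₂ o ∩
      (connEvent ends a₁ a₂)ᶜ) (fun _ h => ⟨h.1.1, h.2⟩),
    prob_a2_edge_of_subset_AQ p he (Y := connEvent ends a₂ b ∩ connEvent ends a₁ a₃ ∩
      (connEvent ends a₁ a₂)ᶜ) (fun _ h => ⟨h.1.2, h.2⟩),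
    prob_a2_edge_of_subset_AQ p he (Y := connEvent ends a₁ a₃ ∩ (connEvent ends a₁ a₂)ᶜ)
      (fun _ h => h),
    prob_eq_pin p (connEvent ends a₁ a₂)ᶜ e₂,
    prob_eq_pin p (connEvent ends a₂ b ∩ (connEvent ends a₁ a₂)ᶜ) e₂]
  ring

end TIdentity

section TSigns
variable {V : Type*} {E : Type*} [Fintype E] [DecidableEq E] [Fintype V] [DecidableEq V]
  {R : Type*} [Field R] [LinearOrder R] [IsStrictOrderedRing R]
variable {ends : E → Sym2 V} {a₁ a₂ a₃ : V} {e₂ : E}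

omit [Fintype V] [DecidableEq V] in
/-- **The form at the forced-open Q-pair dominates the sum of the forms at the PD pair and at the
T-pair** of `G − e₂`, for every `b`-pair `(y₀, y₁)` with `y₁ P₂ − y₀ P₁ ≤ 0`. -/
theorem lamT_c1_ge (p : E → R) (hp : IsProbVec p) (he : ends e₂ = s(a₂, a₃)) (o b : V)
    (y₀ y₁ : R)
    (hB : y₁ * prob (Function.update p e₂ 0) (connEvent ends a₂ b ∩ connEvent ends a₁ a₃ ∩
        (connEvent ends a₁ a₂)ᶜ) -
      y₀ * prob (Function.update p e₂ 0) (connEvent ends a₁ a₃ ∩ (connEvent ends a₁ a₂)ᶜ) ≤ 0) :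
    (Dpd (Function.update p e₂ 0) ends a₁ a₂ a₃ *
        (y₁ * prob (Function.update p e₂ 0) (connEvent ends a₂ b ∩ connEvent ends a₁ a₃ ∩
            connEvent ends a₂ o ∩ (connEvent ends a₁ a₂)ᶜ) -
          y₀ * prob (Function.update p e₂ 0) (connEvent ends a₁ a₃ ∩ connEvent ends a₂ o ∩
            (connEvent ends a₁ a₂)ᶜ)) -
        Dpdo (Function.update p e₂ 0) ends o a₁ a₂ a₃ *
        (y₁ * prob (Function.update p e₂ 0) (connEvent ends a₂ b ∩ connEvent ends a₁ a₃ ∩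
            (connEvent ends a₁ a₂)ᶜ) -
          y₀ * prob (Function.update p e₂ 0) (connEvent ends a₁ a₃ ∩ (connEvent ends a₁ a₂)ᶜ))) +
      (Dt (Function.update p e₂ 0) ends a₁ a₂ a₃ *
        (y₁ * prob (Function.update p e₂ 0) (connEvent ends a₂ b ∩ connEvent ends a₁ a₃ ∩
            connEvent ends a₂ o ∩ (connEvent ends a₁ a₂)ᶜ) -
          y₀ * prob (Function.update p e₂ 0) (connEvent ends a₁ a₃ ∩ connEvent ends a₂ o ∩
            (connEvent ends a₁ a₂)ᶜ)) -
        Dto (Function.update p e₂ 0) ends o a₁ a₂ a₃ *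
        (y₁ * prob (Function.update p e₂ 0) (connEvent ends a₂ b ∩ connEvent ends a₁ a₃ ∩
            (connEvent ends a₁ a₂)ᶜ) -
          y₀ * prob (Function.update p e₂ 0) (connEvent ends a₁ a₃ ∩ (connEvent ends a₁ a₂)ᶜ))) ≤
    prob (Function.update p e₂ 1) (connEvent ends a₁ a₂)ᶜ *
        (y₁ * prob (Function.update p e₂ 0) (connEvent ends a₂ b ∩ connEvent ends a₁ a₃ ∩
            connEvent ends a₂ o ∩ (connEvent ends a₁ a₂)ᶜ) -
          y₀ * prob (Function.update p e₂ 0) (connEvent ends a₁ a₃ ∩ connEvent ends a₂ o ∩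
            (connEvent ends a₁ a₂)ᶜ)) -
        Dqo (Function.update p e₂ 1) ends o a₁ a₂ *
        (y₁ * prob (Function.update p e₂ 0) (connEvent ends a₂ b ∩ connEvent ends a₁ a₃ ∩
            (connEvent ends a₁ a₂)ᶜ) -
          y₀ * prob (Function.update p e₂ 0) (connEvent ends a₁ a₃ ∩ (connEvent ends a₁ a₂)ᶜ)) := by
  have hX := prob_Q_update_one_eq_Dpd_add (a₁ := a₁) p he
  have hU := Dqo_update_one_ge (a₁ := a₁) p hp he o
  have hDt : Dt (Function.update p e₂ 0) ends a₁ a₂ a₃ =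
      prob (Function.update p e₂ 0) (connEvent ends a₂ a₃ ∩ (connEvent ends a₁ a₂)ᶜ) := rfl
  rw [← hDt] at hX
  rw [hX]
  have hprod := mul_le_mul_of_nonpos_right hU hB
  linarith

/-- **The T-pair coefficient `Λ(c_T⁰, y¹)` is nonnegative** when `(ii-T)` holds for `G − e₂`. -/
theorem lamT_c0_y1_nonneg (p : E → R) (hp : IsProbVec p) (he : ends e₂ = s(a₂, a₃)) (o b : V)
    (hT : ZSplitIIT (Function.update p e₂ 0) ends o a₁ a₂ a₃ b) :
    0 ≤ Dt (Function.update p e₂ 0) ends a₁ a₂ a₃ *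
        (prob (Function.update p e₂ 1) (connEvent ends a₁ a₂)ᶜ *
          prob (Function.update p e₂ 0) (connEvent ends a₂ b ∩ connEvent ends a₁ a₃ ∩
            connEvent ends a₂ o ∩ (connEvent ends a₁ a₂)ᶜ) -
        prob (Function.update p e₂ 1) (connEvent ends a₂ b ∩ (connEvent ends a₁ a₂)ᶜ) *
          prob (Function.update p e₂ 0) (connEvent ends a₁ a₃ ∩ connEvent ends a₂ o ∩
            (connEvent ends a₁ a₂)ᶜ)) -
      Dto (Function.update p e₂ 0) ends o a₁ a₂ a₃ *
        (prob (Function.update p e₂ 1) (connEvent ends a₁ a₂)ᶜ *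
          prob (Function.update p e₂ 0) (connEvent ends a₂ b ∩ connEvent ends a₁ a₃ ∩
            (connEvent ends a₁ a₂)ᶜ) -
        prob (Function.update p e₂ 1) (connEvent ends a₂ b ∩ (connEvent ends a₁ a₂)ᶜ) *
          prob (Function.update p e₂ 0) (connEvent ends a₁ a₃ ∩ (connEvent ends a₁ a₂)ᶜ)) := by
  unfold ZSplitIIT at hT
  rw [iiExprT_eq] at hT
  set p₀ := Function.update p e₂ 0 with hp₀
  set p₁ := Function.update p e₂ 1 with hp₁
  have hp0 : IsProbVec p₀ := hp.update e₂ le_rfl zero_le_one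
  have hp1 : IsProbVec p₁ := hp.update e₂ zero_le_one le_rfl
  have hsign := a2_bThreshold_nonneg (a₁ := a₁) p hp he b
  have hodds := odds_t (ends := ends) (a₁ := a₁) (a₂ := a₂) (a₃ := a₃) p₀ hp0 o
  have hX1 : 0 ≤ prob p₁ (connEvent ends a₁ a₂)ᶜ := prob_nonneg hp1 _
  have hX0 : 0 ≤ prob p₀ (connEvent ends a₁ a₂)ᶜ := prob_nonneg hp0 _
  set T := Dt p₀ ends a₁ a₂ a₃ *
        (prob p₁ (connEvent ends a₁ a₂)ᶜ *
          prob p₀ (connEvent ends a₂ b ∩ connEvent ends a₁ a₃ ∩ connEvent ends a₂ o ∩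
            (connEvent ends a₁ a₂)ᶜ) -
        prob p₁ (connEvent ends a₂ b ∩ (connEvent ends a₁ a₂)ᶜ) *
          prob p₀ (connEvent ends a₁ a₃ ∩ connEvent ends a₂ o ∩ (connEvent ends a₁ a₂)ᶜ)) -
      Dto p₀ ends o a₁ a₂ a₃ *
        (prob p₁ (connEvent ends a₁ a₂)ᶜ *
          prob p₀ (connEvent ends a₂ b ∩ connEvent ends a₁ a₃ ∩ (connEvent ends a₁ a₂)ᶜ) -
        prob p₁ (connEvent ends a₂ b ∩ (connEvent ends a₁ a₂)ᶜ) *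
          prob p₀ (connEvent ends a₁ a₃ ∩ (connEvent ends a₁ a₂)ᶜ)) with hTdef
  -- `X₀ · T = X₁ · (ii-T)(p₀) + (X₀ Y₁ − X₁ Y₀)(Dto₀ P₁ − Dt₀ P₃)`
  have key : prob p₀ (connEvent ends a₁ a₂)ᶜ * T =
      prob p₁ (connEvent ends a₁ a₂)ᶜ *
        (Dt p₀ ends a₁ a₂ a₃ *
          (prob p₀ (connEvent ends a₁ a₂)ᶜ *
            prob p₀ (connEvent ends a₂ b ∩ connEvent ends a₁ a₃ ∩ connEvent ends a₂ o ∩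
              (connEvent ends a₁ a₂)ᶜ) -
          prob p₀ (connEvent ends a₂ b ∩ (connEvent ends a₁ a₂)ᶜ) *
            prob p₀ (connEvent ends a₁ a₃ ∩ connEvent ends a₂ o ∩ (connEvent ends a₁ a₂)ᶜ)) -
        Dto p₀ ends o a₁ a₂ a₃ *
          (prob p₀ (connEvent ends a₁ a₂)ᶜ *
            prob p₀ (connEvent ends a₂ b ∩ connEvent ends a₁ a₃ ∩ (connEvent ends a₁ a₂)ᶜ) -
          prob p₀ (connEvent ends a₂ b ∩ (connEvent ends a₁ a₂)ᶜ) *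
            prob p₀ (connEvent ends a₁ a₃ ∩ (connEvent ends a₁ a₂)ᶜ))) +
      (prob p₀ (connEvent ends a₁ a₂)ᶜ * prob p₁ (connEvent ends a₂ b ∩ (connEvent ends a₁ a₂)ᶜ) -
        prob p₁ (connEvent ends a₁ a₂)ᶜ * prob p₀ (connEvent ends a₂ b ∩ (connEvent ends a₁ a₂)ᶜ)) *
      (Dto p₀ ends o a₁ a₂ a₃ * prob p₀ (connEvent ends a₁ a₃ ∩ (connEvent ends a₁ a₂)ᶜ) -
        Dt p₀ ends a₁ a₂ a₃ *
          prob p₀ (connEvent ends a₁ a₃ ∩ connEvent ends a₂ o ∩ (connEvent ends a₁ a₂)ᶜ)) := by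
    rw [hTdef]; ring
  rcases eq_or_lt_of_le hX0 with hX0' | hX0'
  · have hz : ∀ Y : Set (Config E), Y ⊆ (connEvent ends a₁ a₂)ᶜ → prob p₀ Y = 0 := fun Y hY =>
      le_antisymm (by rw [hX0']; exact prob_mono hp0 hY) (prob_nonneg hp0 Y)
    have z4 : prob p₀ (connEvent ends a₂ b ∩ connEvent ends a₁ a₃ ∩ connEvent ends a₂ o ∩
        (connEvent ends a₁ a₂)ᶜ) = 0 := hz _ (fun _ h => h.2)
    have z3 : prob p₀ (connEvent ends a₁ a₃ ∩ connEvent ends a₂ o ∩ (connEvent ends a₁ a₂)ᶜ) = 0 :=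
      hz _ (fun _ h => h.2)
    have z2 : prob p₀ (connEvent ends a₂ b ∩ connEvent ends a₁ a₃ ∩ (connEvent ends a₁ a₂)ᶜ) = 0 :=
      hz _ (fun _ h => h.2)
    have z1 : prob p₀ (connEvent ends a₁ a₃ ∩ (connEvent ends a₁ a₂)ᶜ) = 0 := hz _ (fun _ h => h.2)
    rw [hTdef, z4, z3, z2, z1]
    simp
  · have hprod := mul_nonneg hsign (sub_nonneg.mpr hodds)
    have hrhs := add_nonneg (mul_nonneg hX1 hT) hprod
    rw [← key] at hrhs
    exact nonneg_of_mul_nonneg_right hrhs hX0'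

/-- **`(ii-Q)` lifts along an `a₂a₃`-edge, unconditionally, given the three `(ii)`-side forms of
`G − e₂`.** -/
theorem zSplitIIQ_of_a2_edge_T (p : E → R) (hp : IsProbVec p) (he : ends e₂ = s(a₂, a₃)) (o b : V)
    (hII : ZSplitII (Function.update p e₂ 0) ends o a₁ a₂ a₃ b)
    (hQ : ZSplitIIQ (Function.update p e₂ 0) ends o a₁ a₂ a₃ b)
    (hT : ZSplitIIT (Function.update p e₂ 0) ends o a₁ a₂ a₃ b) :
    ZSplitIIQ p ends o a₁ a₂ a₃ b := by
  unfold ZSplitIIQ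
  rw [iiExprQ_a2_edge p he o b]
  have hr0 : 0 ≤ p e₂ := hp.nonneg e₂
  have hr1 : 0 ≤ 1 - p e₂ := by linarith [hp.le_one e₂]
  have hp0 : IsProbVec (Function.update p e₂ 0) := hp.update e₂ le_rfl zero_le_one
  have c00 : 0 ≤ iiExprT (Function.update p e₂ 0) ends o a₁ a₂ a₃ b
      (Dqo (Function.update p e₂ 0) ends o a₁ a₂) (prob (Function.update p e₂ 0) (connEvent ends a₁ a₂)ᶜ) := hQ
  have c01 := lamQ_c0_y1_nonneg p hp he o b hQ
  have hIIe := hII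
  unfold ZSplitII at hIIe
  rw [iiExpr_eq_iiExprT, iiExprT_eq] at hIIe
  have hTe := hT
  unfold ZSplitIIT at hTe
  rw [iiExprT_eq] at hTe
  have c10 := le_trans (add_nonneg hIIe hTe) (lamT_c1_ge p hp he o b _ _
    (bhk14_cleared (ends := ends) (a₁ := a₁) (a₂ := a₂) (a₃ := a₃) _ hp0 b))
  have c11 := le_trans (add_nonneg (a2MixII_nonneg p hp he o b hII) (lamT_c0_y1_nonneg p hp he o b hT))
    (lamT_c1_ge p hp he o b _ _ (bhk14_forced_open p hp he b))
  have hmid := add_nonneg c01 c10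
  exact mul_nonneg hr1 (add_nonneg (add_nonneg (mul_nonneg (pow_nonneg hr1 2) c00)
    (mul_nonneg (mul_nonneg hr0 hr1) hmid)) (mul_nonneg (pow_nonneg hr0 2) c11))

/-- **`(ii-T)` lifts along an `a₂a₃`-edge**: `(ii)(G − e₂) ∧ (ii-T)(G − e₂) ⟹ (ii-T)(G)`. -/
theorem zSplitIIT_of_a2_edge (p : E → R) (hp : IsProbVec p) (he : ends e₂ = s(a₂, a₃)) (o b : V)
    (hII : ZSplitII (Function.update p e₂ 0) ends o a₁ a₂ a₃ b)
    (hT : ZSplitIIT (Function.update p e₂ 0) ends o a₁ a₂ a₃ b) :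
    ZSplitIIT p ends o a₁ a₂ a₃ b := by
  unfold ZSplitIIT
  rw [iiExprT_a2_edge p he o b]
  have hr0 : 0 ≤ p e₂ := hp.nonneg e₂
  have hr1 : 0 ≤ 1 - p e₂ := by linarith [hp.le_one e₂]
  have hp0 : IsProbVec (Function.update p e₂ 0) := hp.update e₂ le_rfl zero_le_one
  have c00 : 0 ≤ iiExprT (Function.update p e₂ 0) ends o a₁ a₂ a₃ b
      (Dto (Function.update p e₂ 0) ends o a₁ a₂ a₃) (Dt (Function.update p e₂ 0) ends a₁ a₂ a₃) := hT
  have c01 := lamT_c0_y1_nonneg p hp he o b hT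
  have hIIe := hII
  unfold ZSplitII at hIIe
  rw [iiExpr_eq_iiExprT, iiExprT_eq] at hIIe
  have hTe := hT
  unfold ZSplitIIT at hTe
  rw [iiExprT_eq] at hTe
  have c10 := le_trans (add_nonneg hIIe hTe) (lamT_c1_ge p hp he o b _ _
    (bhk14_cleared (ends := ends) (a₁ := a₁) (a₂ := a₂) (a₃ := a₃) _ hp0 b))
  have c11 := le_trans (add_nonneg (a2MixII_nonneg p hp he o b hII) c01)
    (lamT_c1_ge p hp he o b _ _ (bhk14_forced_open p hp he b))
  have hmid := add_nonneg c01 c10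
  exact mul_nonneg hr1 (add_nonneg (add_nonneg (mul_nonneg (pow_nonneg hr1 2) c00)
    (mul_nonneg (mul_nonneg hr0 hr1) hmid)) (mul_nonneg (pow_nonneg hr0 2) c11))

end TSigns

end CaseOne

end Summit.Ventures.PercRepro2
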